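import Summits.MatrixMultiplication.OmegaCensus.SmallFormats.InvertiblePointNearOmegaLaw
import Mathlib.LinearAlgebra.Matrix.NonsingularInverse
import HarnessLib

/-!
# ω-census family (a): RIGHT-EQUIVARIANCE of the near-stage branch data (kernel core of the `K`-orbit reduction)

Cell `pub-omega` (unit `pub-omega-eng1-g28`, ENG1), topic `Summits/MatrixMultiplication/OmegaCensus` (sub-folder `SmallFormats`).
Framing (verbatim): lottery ticket; floor = certified bounds/negative ranges. HONEST FRAMING: three elementary linear-algebra facts, any
field (the first two over any commutative semiring would do), which are the MATHEMATICAL content of the symmetry reduction used by both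
ω-branching near-stage engines of the `𝔽₃` `⟨2,2,6⟩ @ 20` census — ENG1 `omega5` (RESULT-fp5 §3: one branch per `K`-orbit of `P(𝒲_τ^*)`,
`K ⊆ Stab_{GL(V)}(𝒲_τ)`) and tensor `nearomega` v4 (EQUIVARIANCE.md §3) — until now a DESK fact supported by controls (C6/C7/C8, R4–R7).
A group element acts on outputs by RIGHT multiplication `W ↦ W·g` (`g ∈ GL_n(k)`), on functionals by `ω ↦ ω ∘ (· g)`; left data
(`X`, the forms `c_s`, `ψ_s`, the removed class) are untouched. Then:
* (`candidate_mul_right_mem`) candidate lists are `g`-stable: if the type space `P` satisfies `P·g ⊆ P` and `W` lies in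
  `B_f(P) := {W : ∀ X, f(X) = 0 → X·W ∈ P}`, so does `W·g` (`X·(W g) = (X W)·g`);
* (`reduced_functional_mul_right`, `omegaLaw_mul_right_iff`) the ω-law / admissibility equation of `InvertiblePointNearOmegaLaw` for the
  pair `(ω, W·g)` IS the equation for `(ω ∘ (·g), W)`: `ω(X·(W g)) − c(X)·ω(W g) = (ω∘(·g))(X·W) − c(X)·(ω∘(·g))(W)` for every `X`, hence
  `W·g` is admissible for `ω` iff `W` is admissible for `ω∘(·g)` (same constant `κ`) — this is what makes 'one branch per `K`-orbit' sound;
* (`finrank_span_image_mul_right`) for invertible `g`, right multiplication preserves the rank of every finite family: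
  `dim span{W_i·g} = dim span{W_i}` — every prune of the engines ((F) footprint ranks, (A_α), (G_q), (Φ), independence, the span test)
  is the rank of a family `{M_i·W_i}` with FIXED left matrices `M_i`, and `M_i·(W_i g) = (M_i W_i)·g` (`mul_left_family_mul_right`).
What is NOT here (stays engine-side, ×1 desk + controls): that each engine's enumeration visits exactly these sets, the orderly in-branch
symmetry (`K_ω` normal forms), node counts. Nothing on `ω` the exponent.
-/

namespace Summit.MatrixMultiplication.OmegaCensus.SmallFormats

open Module Matrix

variable {k : Type*} [Field k] {m n : ℕ}

section Equivariance

/-- **Candidate lists are stable under the stabiliser.** If right multiplication by `g` maps the type space `P` into itself, then the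
candidate space `B_f(P) = {W : ∀ X, f X = 0 → X·W ∈ P}` of a left form `f` is mapped into itself as well: `X·(W·g) = (X·W)·g`. -/
theorem candidate_mul_right_mem (P : Submodule k (Matrix (Fin m) (Fin n) k)) (g : Matrix (Fin n) (Fin n) k)
    (hP : ∀ W ∈ P, W * g ∈ P) (f : Module.Dual k (Matrix (Fin m) (Fin m) k)) {W : Matrix (Fin m) (Fin n) k}
    (hW : ∀ X : Matrix (Fin m) (Fin m) k, f X = 0 → X * W ∈ P) :
    ∀ X : Matrix (Fin m) (Fin m) k, f X = 0 → X * (W * g) ∈ P := by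
  intro X hX
  rw [← Matrix.mul_assoc]
  exact hP _ (hW X hX)

/-- **The reduced functional transported.** For every functional `ω`, matrices `X, W, g` and scalar `c`:
`ω(X·(W g)) − c·ω(W g) = (ω ∘ (· g))(X·W) − c·(ω ∘ (· g))(W)` — the ω-law expression of `(ω, W·g)` is that of `(ω∘(·g), W)`. -/
theorem reduced_functional_mul_right (ω : Module.Dual k (Matrix (Fin m) (Fin n) k)) (g : Matrix (Fin n) (Fin n) k)
    (X : Matrix (Fin m) (Fin m) k) (W : Matrix (Fin m) (Fin n) k) (c : k) :
    ω (X * (W * g)) - c * ω (W * g) = ω ((X * W) * g) - c * ω (W * g) := by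
  rw [Matrix.mul_assoc]

/-- **Admissibility is equivariant (the ω-law of `InvertiblePointNearOmegaLaw` read through `g`).** With left data `c, ψ` (the engines'
`c_r` and `l_r (c_r − c_{j₀})`) fixed: `W·g` satisfies `∀ X, ω(X·(W g)) − c(X) ω(W g) = κ ψ(X)` iff `W` satisfies the same equation for the
functional `Y ↦ ω(Y·g)`, with the SAME `κ`. Hence the solution set of branch `ω∘(·g)` is carried onto that of branch `ω` by `W ↦ W·g`,
and one representative per orbit of functionals suffices. Any `g` (invertibility is only needed for the converse transport `g⁻¹`). -/
theorem omegaLaw_mul_right_iff (ω : Module.Dual k (Matrix (Fin m) (Fin n) k)) (g : Matrix (Fin n) (Fin n) k)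
    (c ψ : Matrix (Fin m) (Fin m) k → k) (W : Matrix (Fin m) (Fin n) k) (κ : k) :
    (∀ X : Matrix (Fin m) (Fin m) k, ω (X * (W * g)) - c X * ω (W * g) = κ * ψ X) ↔
      (∀ X : Matrix (Fin m) (Fin m) k, ω ((X * W) * g) - c X * ω (W * g) = κ * ψ X) := by
  constructor <;> intro h X
  · rw [Matrix.mul_assoc]; exact h X
  · rw [← Matrix.mul_assoc]; exact h X

/-- **Left families commute with right multiplication.** `M·(W·g) = (M·W)·g` for every left matrix `M` — so each prune family
`{M_i · W_i}` of the engines transforms by the same right multiplication. -/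
theorem mul_left_family_mul_right {ι : Type*} (M : ι → Matrix (Fin m) (Fin m) k) (W : ι → Matrix (Fin m) (Fin n) k)
    (g : Matrix (Fin n) (Fin n) k) (i : ι) : M i * (W i * g) = (M i * W i) * g := by
  rw [Matrix.mul_assoc]

/-- **Right multiplication by an invertible matrix preserves the rank of every family.** For `g` with `IsUnit g.det` and any set `S`
of `m × n` matrices: `dim span (S·g) = dim span S`. (Right multiplication by `g` is a linear automorphism of `k^{m×n}` with inverse
right multiplication by `g⁻¹`.) Consequently every rank-type prune and the span test take the same value on a candidate tuple and on its
`g`-translate. -/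
theorem finrank_span_image_mul_right (g : Matrix (Fin n) (Fin n) k) (hg : IsUnit g.det)
    (S : Set (Matrix (Fin m) (Fin n) k)) :
    finrank k (Submodule.span k ((fun W : Matrix (Fin m) (Fin n) k => W * g) '' S)) = finrank k (Submodule.span k S) := by
  -- right multiplication by `g` as a linear equivalence
  let e : Matrix (Fin m) (Fin n) k ≃ₗ[k] Matrix (Fin m) (Fin n) k :=
    { toFun := fun W => W * g
      invFun := fun W => W * g⁻¹
      map_add' := fun A B => Matrix.add_mul A B g
      map_smul' := fun a A => Matrix.smul_mul a A g
      left_inv := fun W => by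
        show W * g * g⁻¹ = W
        rw [Matrix.mul_assoc, Matrix.mul_nonsing_inv g hg, Matrix.mul_one]
      right_inv := fun W => by
        show W * g⁻¹ * g = W
        rw [Matrix.mul_assoc, Matrix.nonsing_inv_mul g hg, Matrix.mul_one] }
  have himage : (fun W : Matrix (Fin m) (Fin n) k => W * g) '' S = e '' S := rfl
  have hmap : (Submodule.span k S).map (e : Matrix (Fin m) (Fin n) k →ₗ[k] Matrix (Fin m) (Fin n) k) = Submodule.span k (e '' S) := by
    rw [Submodule.map_span, LinearEquiv.coe_coe]
  rw [himage, ← hmap, LinearEquiv.finrank_map_eq]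

/-- **Linear independence of a candidate tuple is `g`-invariant** (the engines' 'basis' requirement): for invertible `g`,
`(W_i·g)_i` is linearly independent iff `(W_i)_i` is. -/
theorem linearIndependent_mul_right_iff {ι : Type*} (g : Matrix (Fin n) (Fin n) k) (hg : IsUnit g.det)
    (W : ι → Matrix (Fin m) (Fin n) k) :
    LinearIndependent k (fun i => W i * g) ↔ LinearIndependent k W := by
  let e : Matrix (Fin m) (Fin n) k ≃ₗ[k] Matrix (Fin m) (Fin n) k :=
    { toFun := fun W => W * g
      invFun := fun W => W * g⁻¹
      map_add' := fun A B => Matrix.add_mul A B g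
      map_smul' := fun a A => Matrix.smul_mul a A g
      left_inv := fun W => by
        show W * g * g⁻¹ = W
        rw [Matrix.mul_assoc, Matrix.mul_nonsing_inv g hg, Matrix.mul_one]
      right_inv := fun W => by
        show W * g⁻¹ * g = W
        rw [Matrix.mul_assoc, Matrix.nonsing_inv_mul g hg, Matrix.mul_one] }
  exact LinearMap.linearIndependent_iff_of_injOn (e : Matrix (Fin m) (Fin n) k →ₗ[k] Matrix (Fin m) (Fin n) k)
    (e.injective.injOn)

end Equivariance

end Summit.MatrixMultiplication.OmegaCensus.SmallFormats
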